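import Literature.NumberTheory.Automorphic.AutomorphicRepCohomologyCoeff
import Literature.NumberTheory.Automorphic.GKCohomologyFunctorAdditive
import HarnessLib

/-!
# Sums and scalars of the action on `H^q(𝔤, K; V ⊗ W)`

Topic `NumberTheory/Automorphic`; namespace `Literature.NumberTheory.Automorphic.GKTensor`.
Complement (one abbreviation with body, theorems; no named fact, no `sorry`) to
`AutomorphicRepCohomologyCoeff` (`GKTensor.cohomologyRep`: a group acting on `V` by `(𝔤, K)`-maps
acts on `H^q(𝔤, K; V ⊗ W)` through `r(γ) ⊗ 1`) and `GKCohomologyFunctorAdditive`: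

* `GKTensor.rTensorCohomologyHom … T hT𝔤 hTK q` — `H^q(T ⊗ 1)` for any `T : V → V` commuting with
  the actions (the tree's `gkCohomologyHom` on `V ⊗ W`); `cohomologyRep_apply_eq` (`γ` acts by
  `H^q(r(γ) ⊗ 1)`), `rTensorCohomologyHom_congr`;
* `GKTensor.sum_rTensorCohomologyHom`, `GKTensor.sum_cohomologyRep_apply` — **a finite sum of group
  elements acts by `H^q((∑ᵢ r(γᵢ)) ⊗ 1)`** (additivity of `H^q` in the morphism and of `· ⊗ 1`);
* `GKTensor.rTensorCohomologyHom_smul_one` — `H^q((c • 1) ⊗ 1) = c`.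

With these, a Hecke operator `∑_{y} r(ι_w y)` on `H^q(𝔤, K_∞; π ⊗ E)` that acts by a scalar on the
relevant invariants of `π` acts by the same scalar on cohomology (Eichler–Shimura–Harder glue,
Harder 1987, §3; Borel–Wallach I §5.1).

## References
* [BorelWallach2000] A. Borel, N. Wallach, *Continuous cohomology, discrete subgroups, and
  representations of reductive groups*, 2nd ed., AMS 2000, I §1.2, §5.1.
-/

noncomputable section

namespace Literature.NumberTheory.Automorphic

open Module Literature.Algebra.Lie
open scoped TensorProduct

-- Mathlib idiom (as in `GKModules`): commutator bracket on `Module.End`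
attribute [local instance 100] LieRing.ofAssociativeRing

/- [extends Literature/NumberTheory/Automorphic/AutomorphicRepCohomologyCoeff]: sums and scalars
of the `Γ`-action `GKTensor.cohomologyRep`. -/

variable {A : Type*} [NormedCommRing A] [NormedAlgebra ℝ A] [NormedAlgebra ℚ A] [CompleteSpace A]
  [StarRing A] [StarModule ℝ A] {N : Type*} [Fintype N] [DecidableEq N] (G : RealMatrixGroup A N)
  {V : Type*} [AddCommGroup V] [Module ℂ V]
  (ρK : Representation ℂ G.maximalCompact V) (ρ𝔤 : G.lie →ₗ⁅ℝ⁆ Module.End ℂ V)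
  {W : Type*} [AddCommGroup W] [Module ℂ W]
  (σK : Representation ℂ G.maximalCompact W) (σ𝔤 : G.lie →ₗ⁅ℝ⁆ Module.End ℂ W)
  (hV : ∀ (k : G.maximalCompact) (X : G.lie),
    ρK k ∘ₗ ρ𝔤 X ∘ₗ ρK k⁻¹ = ρ𝔤 (G.Ad (Subgroup.inclusion G.maximalCompact_le_carrier k) X))
  (hW : ∀ (k : G.maximalCompact) (X : G.lie),
    σK k ∘ₗ σ𝔤 X ∘ₗ σK k⁻¹ = σ𝔤 (G.Ad (Subgroup.inclusion G.maximalCompact_le_carrier k) X))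

namespace GKTensor

/-- `H^q` of `T ⊗ 1` for any `T` commuting with the actions on `V` (abbreviation of the tree's
`gkCohomologyHom` on `V ⊗ W`). [cite: BorelWallach2000, I §5.1] -/
abbrev rTensorCohomologyHom (T : V →ₗ[ℂ] V) (hT𝔤 : ∀ X : G.lie, T ∘ₗ ρ𝔤 X = ρ𝔤 X ∘ₗ T)
    (hTK : ∀ k : G.maximalCompact, T ∘ₗ ρK k = ρK k ∘ₗ T) (q : ℕ) :
    GKTensor.cohomology G ρK ρ𝔤 σK σ𝔤 hV hW q →ₗ[ℂ] GKTensor.cohomology G ρK ρ𝔤 σK σ𝔤 hV hW q :=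
  gkCohomologyHom G (ρK.tprod σK) (GKTensor.lie G ρ𝔤 σ𝔤) (ρK.tprod σK) (GKTensor.lie G ρ𝔤 σ𝔤)
    (GKTensor.ad_compat G ρK ρ𝔤 σK σ𝔤 hV hW) (GKTensor.ad_compat G ρK ρ𝔤 σK σ𝔤 hV hW)
    (T.rTensor W) (rTensor_comm_lie G ρ𝔤 σ𝔤 T hT𝔤) (rTensor_comm_tprod G ρK σK T hTK) q

/-- The `Γ`-action on `H^q(𝔤, K; V ⊗ W)` is `H^q(r(γ) ⊗ 1)` (the tree's `cohomologyRep_apply`).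
[folklore] -/
theorem cohomologyRep_apply_eq {Γ : Type*} [Group Γ] (r : Representation ℂ Γ V)
    (hr𝔤 : ∀ (γ : Γ) (X : G.lie), r γ ∘ₗ ρ𝔤 X = ρ𝔤 X ∘ₗ r γ)
    (hrK : ∀ (γ : Γ) (k : G.maximalCompact), r γ ∘ₗ ρK k = ρK k ∘ₗ r γ) (q : ℕ) (γ : Γ) :
    cohomologyRep G ρK ρ𝔤 σK σ𝔤 hV hW r hr𝔤 hrK q γ =
      rTensorCohomologyHom G ρK ρ𝔤 σK σ𝔤 hV hW (r γ) (hr𝔤 γ) (hrK γ) q := rfl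

/-- **`H^q` of `T ⊗ 1` only depends on `T`.** [folklore] -/
theorem rTensorCohomologyHom_congr {T T' : V →ₗ[ℂ] V} (h : T = T')
    (hT𝔤 : ∀ X : G.lie, T ∘ₗ ρ𝔤 X = ρ𝔤 X ∘ₗ T) (hTK : ∀ k : G.maximalCompact, T ∘ₗ ρK k = ρK k ∘ₗ T)
    (hT'𝔤 : ∀ X : G.lie, T' ∘ₗ ρ𝔤 X = ρ𝔤 X ∘ₗ T')
    (hT'K : ∀ k : G.maximalCompact, T' ∘ₗ ρK k = ρK k ∘ₗ T') (q : ℕ) :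
    rTensorCohomologyHom G ρK ρ𝔤 σK σ𝔤 hV hW T hT𝔤 hTK q =
      rTensorCohomologyHom G ρK ρ𝔤 σK σ𝔤 hV hW T' hT'𝔤 hT'K q := by
  subst h
  rfl

/-- **Sums**: `∑ᵢ H^q(Tᵢ ⊗ 1) = H^q((∑ᵢ Tᵢ) ⊗ 1)`. [cite: BorelWallach2000, I §1.2, §5.1] -/
theorem sum_rTensorCohomologyHom {ι : Type*} (s : Finset ι) (T : ι → V →ₗ[ℂ] V)
    (h𝔤 : ∀ i X, T i ∘ₗ ρ𝔤 X = ρ𝔤 X ∘ₗ T i) (hK : ∀ i k, T i ∘ₗ ρK k = ρK k ∘ₗ T i) (q : ℕ)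
    (x : GKTensor.cohomology G ρK ρ𝔤 σK σ𝔤 hV hW q) :
    ∑ i ∈ s, rTensorCohomologyHom G ρK ρ𝔤 σK σ𝔤 hV hW (T i) (h𝔤 i) (hK i) q x =
      rTensorCohomologyHom G ρK ρ𝔤 σK σ𝔤 hV hW (∑ i ∈ s, T i)
        (sum_comm𝔤 G ρ𝔤 ρ𝔤 s T h𝔤) (sum_commK G ρK ρK s T hK) q x := by
  have hsum : (∑ i ∈ s, (T i).rTensor W) = (∑ i ∈ s, T i).rTensor W := by
    change (∑ i ∈ s, LinearMap.rTensorHom W (T i)) = LinearMap.rTensorHom W (∑ i ∈ s, T i)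
    rw [map_sum]
  unfold rTensorCohomologyHom
  rw [← gkCohomologyHom_sum G (ρK.tprod σK) (GKTensor.lie G ρ𝔤 σ𝔤) (ρK.tprod σK)
      (GKTensor.lie G ρ𝔤 σ𝔤) _ _ s (fun i => (T i).rTensor W)
      (fun i => rTensor_comm_lie G ρ𝔤 σ𝔤 (T i) (h𝔤 i))
      (fun i => rTensor_comm_tprod G ρK σK (T i) (hK i))
      (sum_comm𝔤 G _ _ s _ fun i => rTensor_comm_lie G ρ𝔤 σ𝔤 (T i) (h𝔤 i))
      (sum_commK G _ _ s _ fun i => rTensor_comm_tprod G ρK σK (T i) (hK i)) q x]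
  exact LinearMap.congr_fun (gkCohomologyHom_congr G _ _ _ _ _ _ hsum _ _ _ _ q) x

/-- **The action of a finite sum of group elements**: `∑ᵢ γᵢ · x = H^q((∑ᵢ r(γᵢ)) ⊗ 1) x`.
[cite: BorelWallach2000, I §5.1] -/
theorem sum_cohomologyRep_apply {Γ : Type*} [Group Γ] (r : Representation ℂ Γ V)
    (hr𝔤 : ∀ (γ : Γ) (X : G.lie), r γ ∘ₗ ρ𝔤 X = ρ𝔤 X ∘ₗ r γ)
    (hrK : ∀ (γ : Γ) (k : G.maximalCompact), r γ ∘ₗ ρK k = ρK k ∘ₗ r γ) (q : ℕ)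
    {ι : Type*} (s : Finset ι) (γ : ι → Γ) (x : GKTensor.cohomology G ρK ρ𝔤 σK σ𝔤 hV hW q) :
    ∑ i ∈ s, cohomologyRep G ρK ρ𝔤 σK σ𝔤 hV hW r hr𝔤 hrK q (γ i) x =
      rTensorCohomologyHom G ρK ρ𝔤 σK σ𝔤 hV hW (∑ i ∈ s, r (γ i))
        (sum_comm𝔤 G ρ𝔤 ρ𝔤 s (fun i => r (γ i)) fun i => hr𝔤 (γ i))
        (sum_commK G ρK ρK s (fun i => r (γ i)) fun i => hrK (γ i)) q x :=
  sum_rTensorCohomologyHom G ρK ρ𝔤 σK σ𝔤 hV hW s (fun i => r (γ i)) (fun i => hr𝔤 (γ i))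
    (fun i => hrK (γ i)) q x

/-- **Scalars**: `H^q((c • 1) ⊗ 1) = c`. [folklore] -/
theorem rTensorCohomologyHom_smul_one (c : ℂ)
    (h𝔤 : ∀ X : G.lie, (c • LinearMap.id : V →ₗ[ℂ] V) ∘ₗ ρ𝔤 X = ρ𝔤 X ∘ₗ (c • LinearMap.id))
    (hK : ∀ k : G.maximalCompact, (c • LinearMap.id : V →ₗ[ℂ] V) ∘ₗ ρK k = ρK k ∘ₗ (c • LinearMap.id))
    (q : ℕ) (x : GKTensor.cohomology G ρK ρ𝔤 σK σ𝔤 hV hW q) :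
    rTensorCohomologyHom G ρK ρ𝔤 σK σ𝔤 hV hW (c • LinearMap.id) h𝔤 hK q x = c • x := by
  unfold rTensorCohomologyHom
  have hid𝔤 : ∀ X : G.lie, (LinearMap.id : V →ₗ[ℂ] V) ∘ₗ ρ𝔤 X = ρ𝔤 X ∘ₗ LinearMap.id := fun X => by
    rw [LinearMap.id_comp, LinearMap.comp_id]
  have hidK : ∀ k : G.maximalCompact, (LinearMap.id : V →ₗ[ℂ] V) ∘ₗ ρK k = ρK k ∘ₗ LinearMap.id :=
    fun k => by rw [LinearMap.id_comp, LinearMap.comp_id]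
  have hsm : ((c • LinearMap.id : V →ₗ[ℂ] V).rTensor W) = c • (LinearMap.id : V →ₗ[ℂ] V).rTensor W := by
    rw [LinearMap.rTensor_smul]
  rw [LinearMap.congr_fun (gkCohomologyHom_congr G _ _ _ _ _ _ hsm _ _
      (fun X => by rw [← hsm]; exact rTensor_comm_lie G ρ𝔤 σ𝔤 _ h𝔤 X)
      (fun k => by rw [← hsm]; exact rTensor_comm_tprod G ρK σK _ hK k)
      q) x,
    gkCohomologyHom_smul_left G _ _ _ _ _ _ c ((LinearMap.id : V →ₗ[ℂ] V).rTensor W)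
      (rTensor_comm_lie G ρ𝔤 σ𝔤 _ hid𝔤) (rTensor_comm_tprod G ρK σK _ hidK)]
  congr 1
  rw [LinearMap.congr_fun (gkCohomologyHom_congr G _ _ _ _ _ _ (LinearMap.rTensor_id W _)
      _ _ (fun X => by rw [LinearMap.id_comp, LinearMap.comp_id])
      (fun k => by rw [LinearMap.id_comp, LinearMap.comp_id]) q) x]
  exact gkCohomologyHom_id G _ _ _ q x

end GKTensor

end Literature.NumberTheory.Automorphic

end
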